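import Summits.CriticalPhenomena.PercolationContinuityZ3.Theorems.PercNearOneGluingNoHeavyLowerTailAttachedChampionNotLonelier
import Summits.CriticalPhenomena.PercolationContinuityZ3.Theorems.PercNearOneGluingNoHeavyLowerTailChampionStability
import HarnessLib

/-!
# `NoHeavyLowerTail` (stmt-CriticalPhenomena-4575) — exchange tools: AWAY-domination, block domination, light-side exchange

Support file (prover `prim-lf-3`, lemma factory #3 (submodularity / electrical-network analogies), gen 3;
`--supports stmt-CriticalPhenomena-4575`).  No definitions, no named facts, no sorries.

Bond percolation `μ = prodBernoulli w` on `Fin n`, relays `A`, level `j`, `M_v = |{x ∈ A : v ↔ x}|` ("`v` light" = `M_v ≤ j`).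
Three corollaries of the two-cluster exchange rows of van den Berg–Häggström–Kahn (2006, Thm. 1.5) that are already in the
tree (`AttachedChampionNotLonelier.attachedSet_row` = ROW-O, `AttachedChampionObserverExchange.observer_row` = ROW-T):

* `ExchangeTools.away` (**AWAY-domination**): if `μ(M_y ≤ j) ≤ μ(M_q ≤ j)` then for EVERY finite vertex set `W`
  `μ(q ↮ W, M_y ≤ j) ≤ μ(q ↮ W, M_q ≤ j)` — the domination of `y` by `q` survives the decreasing event "`q` is joined to no
  vertex of `W`".  (ROW-O says `P(q ↔ W | q light, y heavy) ≤ P(q ↔ W | q heavy, y light)`; complement and cross-multiply.)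
* `ExchangeTools.blockLight_le_of_away` (**block domination**): if `q` dominates ONE member `y ∈ Y` then, away from `Y`, `q` dominates the
  glued block `Y`: `μ(q ↮ Y, |⋃_{y ∈ Y} π(y)| ≤ j) ≤ μ(q ↮ Y, M_q ≤ j)`.
* `ExchangeTools.lightSide_exchange` (**light-side exchange**): for vertices `g₁, g₂, c`, if
  `μ(M_{g₂} ≤ j < M_{g₁}) ≤ μ(M_{g₁} ≤ j < M_{g₂})` (e.g. `μ(M_{g₂} ≤ j) ≤ μ(M_{g₁} ≤ j)`), then
  `μ(c ↔ g₂, M_{g₂} ≤ j < M_{g₁}) ≤ μ(c ↮ g₁, M_{g₁} ≤ j < M_{g₂})`: "the light side of a light/heavy pair is more likely the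
  dominating one, even after asking that the marker `c` hang on the light side".

* `ExchangeTools.glueCost_le` (**glue-cost domination**): for relays `q ≠ p` and any vertex `h` with `w s(q,h) = 0`, if
  `μ(M_p ≤ j) ≤ μ(M_q ≤ j)` then gluing `q` onto `h` (raising `s(q,h)` to weight `1`) costs `p` at most what it costs `q`:
  `μ_w(M_p ≤ j) − μ_{w[s(q,h)↦1]}(M_p ≤ j) ≤ μ_w(M_q ≤ j) − μ_{w[s(q,h)↦1]}(M_q ≤ j)`  (the lead of `q` over `p` does not grow).
  This is the termwise form of the stage inequality of the averaged-port / exploration scheme ("own cost ≥ cross cost on every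
  dominated port", with any passengers at `h`); numerically 0 / 42 527, and 0 / 46 408 for domination measured in `w` minus the
  edges at `h` (that variant needs the set form of ROW-T and is not in this file).

These are the probabilistic inputs of the cost-transfer proof of the averaged port lemma with the `(G − o)`-sorted port order
and of its pendant-star / hull extensions (memo `run/shared/lean/prim/prim-lf-3/LF3-EXCHANGE.md`; numerically AWAY 0 / 101 648,
block form 0 / 61 552, light-side exchange 0 / 40 407 (graph, level, triple) cases incl. non-relay vertices).
-/

noncomputable section

namespace Summit.CriticalPhenomena.PercolationContinuityZ3.Theorems

open MeasureTheory Set Literature.Probability.LatticeModels Literature.Probability.Percolation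
open scoped Classical BigOperators

variable {n : ℕ}

namespace ExchangeTools

open AttachedChampionObserverExchange AttachedChampionNotLonelier

/-- Elementary: from `a·y ≤ c·x`, `c ≤ y ≤ x`, `a ≤ x`, all nonnegative, conclude `y − c ≤ x − a`
(the cross-multiplied conditional comparison, integrated). -/
theorem sub_le_sub_of_row {a c x y : ℝ} (hc : 0 ≤ c) (hax : a ≤ x) (hcy : c ≤ y) (hyx : y ≤ x)
    (hrow : a * y ≤ c * x) : y - c ≤ x - a := by
  by_cases hy : y = 0
  · have hc0 : c = 0 := le_antisymm (hy ▸ hcy) hc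
    rw [hy, hc0]; linarith
  · have hypos : 0 < y := lt_of_le_of_ne (hc.trans hcy) (Ne.symm hy)
    have key : (y - c) * y ≤ (x - a) * y := by nlinarith [mul_nonneg (sub_nonneg.2 hyx) (sub_nonneg.2 hcy)]
    exact le_of_mul_le_mul_right key hypos

/-- **AWAY-domination.**  If `μ(M_y ≤ j) ≤ μ(M_q ≤ j)` then for every finite vertex set `W`:
`μ(q ↮ W, M_y ≤ j) ≤ μ(q ↮ W, M_q ≤ j)` (`q ↮ W` = `q` joined to no vertex of `W`; `q, y, W` arbitrary).
[derived from: VandenbergHaggstromKahn2005, Thm. 1.5, via `AttachedChampionNotLonelier.attachedSet_row`] -/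
theorem away (w : Sym2 (Fin n) → unitInterval) (A W : Finset (Fin n)) (q y : Fin n) (j : ℕ)
    (h : (prodBernoulli w).real {ω : BondConfig (Fin n) | (A.filter fun x => ω ∈ openConn y x).card ≤ j} ≤
      (prodBernoulli w).real {ω : BondConfig (Fin n) | (A.filter fun x => ω ∈ openConn q x).card ≤ j}) :
    (prodBernoulli w).real ({ω : BondConfig (Fin n) | ∀ v ∈ W, ω ∉ openConn q v} ∩
        {ω | (A.filter fun x => ω ∈ openConn y x).card ≤ j}) ≤
      (prodBernoulli w).real ({ω : BondConfig (Fin n) | ∀ v ∈ W, ω ∉ openConn q v} ∩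
        {ω | (A.filter fun x => ω ∈ openConn q x).card ≤ j}) := by
  set μ := prodBernoulli w with hμ
  haveI : IsProbabilityMeasure μ := by rw [hμ]; infer_instance
  have hmeas : ∀ s : Set (BondConfig (Fin n)), MeasurableSet s := fun _ => MeasurableSet.of_discrete
  set U : Set (BondConfig (Fin n)) := ⋃ a ∈ W, (openConn q a : Set (BondConfig (Fin n))) with hU
  set D : Set (BondConfig (Fin n)) := {ω | ∀ v ∈ W, ω ∉ openConn q v} with hD
  set Rq : Set (BondConfig (Fin n)) := {ω | (A.filter fun x => ω ∈ openConn q x).card ≤ j} with hRq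
  set Ry : Set (BondConfig (Fin n)) := {ω | (A.filter fun x => ω ∈ openConn y x).card ≤ j} with hRy
  -- X = {q light, y heavy}, Y = {q heavy, y light}
  set X : Set (BondConfig (Fin n)) := {ω | (A.filter fun x => ω ∈ openConn q x).card ≤ j ∧
    j < (A.filter fun x => ω ∈ openConn y x).card} with hX
  set Y : Set (BondConfig (Fin n)) := {ω | j < (A.filter fun x => ω ∈ openConn q x).card ∧
    (A.filter fun x => ω ∈ openConn y x).card ≤ j} with hY
  have hDU : D = Uᶜ := by
    ext ω; simp only [hD, hU, mem_setOf_eq, mem_compl_iff, mem_iUnion, exists_prop, not_exists, not_and]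
  -- the row: μ(U ∩ X) μ(Y) ≤ μ(U ∩ Y) μ(X)
  have hrow : μ.real (U ∩ X) * μ.real Y ≤ μ.real (U ∩ Y) * μ.real X := attachedSet_row w A W q y j
  -- the comparison μ(Y) ≤ μ(X)
  have hYX : μ.real Y ≤ μ.real X := by
    have h1 := exchange_of_lonelier w A y q j h
    have e1 : {ω : BondConfig (Fin n) | (A.filter fun x => ω ∈ openConn y x).card ≤ j ∧
        j < (A.filter fun x => ω ∈ openConn q x).card} = Y := by
      ext ω; simp only [hY, mem_setOf_eq]; tauto
    have e2 : {ω : BondConfig (Fin n) | j < (A.filter fun x => ω ∈ openConn y x).card ∧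
        (A.filter fun x => ω ∈ openConn q x).card ≤ j} = X := by
      ext ω; simp only [hX, mem_setOf_eq]; tauto
    rw [e1, e2] at h1; exact h1
  -- μ(D ∩ X) = μ(X) - μ(U ∩ X), and the same for Y
  have hsplit : ∀ Z : Set (BondConfig (Fin n)), μ.real (D ∩ Z) = μ.real Z - μ.real (U ∩ Z) := by
    intro Z
    have := measureReal_inter_add_sdiff (μ := μ) (s := Z) (t := U) (hmeas U)
    have e : Z \ U = D ∩ Z := by rw [hDU, inter_comm]; rfl
    rw [inter_comm Z U, e] at this
    linarith
  have hkey : μ.real Y - μ.real (U ∩ Y) ≤ μ.real X - μ.real (U ∩ X) :=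
    sub_le_sub_of_row measureReal_nonneg
      (measureReal_mono inter_subset_right (measure_ne_top μ _))
      (measureReal_mono inter_subset_right (measure_ne_top μ _)) hYX hrow
  -- split the light events along the other vertex's lightness
  have hq : μ.real (D ∩ Rq) = μ.real ((D ∩ Rq) ∩ Ry) + μ.real ((D ∩ Rq) \ Ry) :=
    (measureReal_inter_add_sdiff (μ := μ) (s := D ∩ Rq) (t := Ry) (hmeas Ry)).symm
  have hy : μ.real (D ∩ Ry) = μ.real ((D ∩ Ry) ∩ Rq) + μ.real ((D ∩ Ry) \ Rq) :=
    (measureReal_inter_add_sdiff (μ := μ) (s := D ∩ Ry) (t := Rq) (hmeas Rq)).symm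
  rw [light_sdiff_light_eq A q y j D] at hq
  rw [light_sdiff_light_eq A y q j D, ← light_inter_light_comm A q y j D] at hy
  have hYeq : D ∩ {ω : BondConfig (Fin n) | (A.filter fun x => ω ∈ openConn y x).card ≤ j ∧
      j < (A.filter fun x => ω ∈ openConn q x).card} = D ∩ Y := by
    ext ω; simp only [hY, mem_inter_iff, mem_setOf_eq]; tauto
  rw [hYeq] at hy
  rw [hq, hy, hsplit X, hsplit Y]
  linarith

/-- **Block domination away from the block.**  If `q` dominates some `y ∈ Y` (`μ(M_y ≤ j) ≤ μ(M_q ≤ j)`), then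
`μ(q ↮ Y, |{x ∈ A : ∃ y ∈ Y, y ↔ x}| ≤ j) ≤ μ(q ↮ Y, M_q ≤ j)`: away from the glued block `Y`, `q` dominates the block.
[derived from: VandenbergHaggstromKahn2005, Thm. 1.5, via `away`] -/
theorem blockLight_le_of_away (w : Sym2 (Fin n) → unitInterval) (A Y : Finset (Fin n)) (q y : Fin n) (j : ℕ)
    (hy : y ∈ Y)
    (h : (prodBernoulli w).real {ω : BondConfig (Fin n) | (A.filter fun x => ω ∈ openConn y x).card ≤ j} ≤
      (prodBernoulli w).real {ω : BondConfig (Fin n) | (A.filter fun x => ω ∈ openConn q x).card ≤ j}) :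
    (prodBernoulli w).real ({ω : BondConfig (Fin n) | ∀ v ∈ Y, ω ∉ openConn q v} ∩
        {ω | (A.filter fun x => ∃ v ∈ Y, ω ∈ openConn v x).card ≤ j}) ≤
      (prodBernoulli w).real ({ω : BondConfig (Fin n) | ∀ v ∈ Y, ω ∉ openConn q v} ∩
        {ω | (A.filter fun x => ω ∈ openConn q x).card ≤ j}) := by
  refine le_trans (measureReal_mono ?_ (measure_ne_top _ _)) (away w A Y q y j h)
  rintro ω ⟨hD, hL⟩
  refine ⟨hD, ?_⟩
  change (A.filter fun x => ∃ v ∈ Y, ω ∈ openConn v x).card ≤ j at hL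
  change (A.filter fun x => ω ∈ openConn y x).card ≤ j
  refine le_trans (Finset.card_le_card fun x hx => ?_) hL
  simp only [Finset.mem_filter] at hx ⊢
  exact ⟨hx.1, y, hy, hx.2⟩

/-- **Light-side exchange.**  For vertices `g₁, g₂, c`: if `μ(M_{g₂} ≤ j < M_{g₁}) ≤ μ(M_{g₁} ≤ j < M_{g₂})`, then
`μ(c ↔ g₂, M_{g₂} ≤ j < M_{g₁}) ≤ μ(c ↮ g₁, M_{g₁} ≤ j < M_{g₂})`.
[derived from: VandenbergHaggstromKahn2005, Thm. 1.5, via `AttachedChampionObserverExchange.observer_row`] -/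
theorem lightSide_exchange (w : Sym2 (Fin n) → unitInterval) (A : Finset (Fin n)) (g₁ g₂ c : Fin n) (j : ℕ)
    (h : (prodBernoulli w).real
        {ω : BondConfig (Fin n) | (A.filter fun x => ω ∈ openConn g₂ x).card ≤ j ∧
          j < (A.filter fun x => ω ∈ openConn g₁ x).card} ≤
      (prodBernoulli w).real
        {ω : BondConfig (Fin n) | (A.filter fun x => ω ∈ openConn g₁ x).card ≤ j ∧
          j < (A.filter fun x => ω ∈ openConn g₂ x).card}) :
    (prodBernoulli w).real ((openConn c g₂ : Set (BondConfig (Fin n))) ∩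
        {ω | (A.filter fun x => ω ∈ openConn g₂ x).card ≤ j ∧ j < (A.filter fun x => ω ∈ openConn g₁ x).card}) ≤
      (prodBernoulli w).real ({ω : BondConfig (Fin n) | ω ∉ openConn c g₁} ∩
        {ω | (A.filter fun x => ω ∈ openConn g₁ x).card ≤ j ∧ j < (A.filter fun x => ω ∈ openConn g₂ x).card}) := by
  set μ := prodBernoulli w with hμ
  haveI : IsProbabilityMeasure μ := by rw [hμ]; infer_instance
  set E : Set (BondConfig (Fin n)) := openConn c g₂ with hE
  -- A2 = {g₂ light, g₁ heavy}, A1 = {g₁ light, g₂ heavy} (written with g₂ first, as the row states it)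
  set A2 : Set (BondConfig (Fin n)) := {ω | (A.filter fun x => ω ∈ openConn g₂ x).card ≤ j ∧
    j < (A.filter fun x => ω ∈ openConn g₁ x).card} with hA2
  set A1 : Set (BondConfig (Fin n)) := {ω | j < (A.filter fun x => ω ∈ openConn g₂ x).card ∧
    (A.filter fun x => ω ∈ openConn g₁ x).card ≤ j} with hA1
  have hA1eq : {ω : BondConfig (Fin n) | (A.filter fun x => ω ∈ openConn g₁ x).card ≤ j ∧
      j < (A.filter fun x => ω ∈ openConn g₂ x).card} = A1 := by
    ext ω; simp only [hA1, mem_setOf_eq]; tauto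
  rw [hA1eq] at h ⊢
  -- ROW-T with `o := c`, `b := g₂`, `q := g₁`:  μ(E ∩ A2) μ(A1) ≤ μ(E ∩ A1) μ(A2)
  have hrow : μ.real (E ∩ A2) * μ.real A1 ≤ μ.real (E ∩ A1) * μ.real A2 := observer_row w A c g₂ g₁ j
  -- hence μ(E ∩ A2) ≤ μ(E ∩ A1)
  have hstep : μ.real (E ∩ A2) ≤ μ.real (E ∩ A1) := by
    by_cases h0 : μ.real A1 = 0
    · have hA2z : μ.real A2 ≤ 0 := h.trans (le_of_eq h0)
      have : μ.real (E ∩ A2) ≤ μ.real A2 := measureReal_mono inter_subset_right (measure_ne_top μ _)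
      exact (this.trans hA2z).trans measureReal_nonneg
    · have hpos : 0 < μ.real A1 := lt_of_le_of_ne measureReal_nonneg (Ne.symm h0)
      have h2 : μ.real (E ∩ A2) * μ.real A1 ≤ μ.real (E ∩ A1) * μ.real A1 :=
        hrow.trans (mul_le_mul_of_nonneg_left h measureReal_nonneg)
      exact le_of_mul_le_mul_right h2 hpos
  -- and E ∩ A1 ⊆ {c ↮ g₁} ∩ A1: on A1 the clusters of g₁, g₂ have different relay counts, so c cannot hang on both
  refine hstep.trans (measureReal_mono ?_ (measure_ne_top μ _))
  rintro ω ⟨hc2, hω⟩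
  refine ⟨fun hc1 => ?_, hω⟩
  have h21 : (openGraph ω).Reachable g₂ g₁ := by
    have a : (openGraph ω).Reachable c g₂ := hc2
    have b : (openGraph ω).Reachable c g₁ := hc1
    exact a.symm.trans b
  have heq := card_eq_of_reachable A h21
  have h1 : j < (A.filter fun x => ω ∈ openConn g₂ x).card := hω.1
  have h2 : (A.filter fun x => ω ∈ openConn g₁ x).card ≤ j := hω.2
  omega

/-- **Light-side exchange from plain domination**: if `μ(M_{g₂} ≤ j) ≤ μ(M_{g₁} ≤ j)` then
`μ(c ↔ g₂, M_{g₂} ≤ j < M_{g₁}) ≤ μ(c ↮ g₁, M_{g₁} ≤ j < M_{g₂})`. -/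
theorem lightSide_exchange_of_le (w : Sym2 (Fin n) → unitInterval) (A : Finset (Fin n)) (g₁ g₂ c : Fin n) (j : ℕ)
    (h : (prodBernoulli w).real {ω : BondConfig (Fin n) | (A.filter fun x => ω ∈ openConn g₂ x).card ≤ j} ≤
      (prodBernoulli w).real {ω : BondConfig (Fin n) | (A.filter fun x => ω ∈ openConn g₁ x).card ≤ j}) :
    (prodBernoulli w).real ((openConn c g₂ : Set (BondConfig (Fin n))) ∩
        {ω | (A.filter fun x => ω ∈ openConn g₂ x).card ≤ j ∧ j < (A.filter fun x => ω ∈ openConn g₁ x).card}) ≤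
      (prodBernoulli w).real ({ω : BondConfig (Fin n) | ω ∉ openConn c g₁} ∩
        {ω | (A.filter fun x => ω ∈ openConn g₁ x).card ≤ j ∧ j < (A.filter fun x => ω ∈ openConn g₂ x).card}) := by
  refine lightSide_exchange w A g₁ g₂ c j ?_
  have h1 := exchange_of_lonelier w A g₂ g₁ j h
  have e : {ω : BondConfig (Fin n) | j < (A.filter fun x => ω ∈ openConn g₂ x).card ∧
      (A.filter fun x => ω ∈ openConn g₁ x).card ≤ j} =
      {ω | (A.filter fun x => ω ∈ openConn g₁ x).card ≤ j ∧ j < (A.filter fun x => ω ∈ openConn g₂ x).card} := by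
    ext ω; simp only [mem_setOf_eq]; tauto
  rw [e] at h1; exact h1

/-! ### Glue-cost domination -/

/-- **Glue-cost domination.**  Relays... any vertices `q ≠ h`, `p` with `μ(M_p ≤ j) ≤ μ(M_q ≤ j)` and `w s(q,h) = 0`; `w₁ = w[s(q,h) ↦ 1]`
(`q` glued onto `h`).  Then `μ_w(M_p ≤ j) − μ_{w₁}(M_p ≤ j) ≤ μ_w(M_q ≤ j) − μ_{w₁}(M_q ≤ j)`.
Proof: in `w`-space the two differences are the masses of `D_v = {M_v ≤ j < M_v(· ∪ {s(q,h)})}`; one checks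
`D_p ⊆ D_q ∪ W₂`, `W₁ ⊆ D_q`, `D_p ∩ W₁ = ∅` with `W₁ = {h ↔ p, M_q ≤ j < M_p}`, `W₂ = {h ↔ p, M_p ≤ j < M_q}`, and
`μ(W₂) ≤ μ(W₁)` is ROW-T (`observer_exchange_step`). [derived from: VandenbergHaggstromKahn2005, Thm. 1.5, via `observer_row`] -/
theorem glueCost_le (w : Sym2 (Fin n) → unitInterval) (A : Finset (Fin n)) (q h p : Fin n) (j : ℕ)
    (hqh : q ≠ h) (hw0 : w s(q, h) = 0)
    (hdom : (prodBernoulli w).real {ω : BondConfig (Fin n) | (A.filter fun x => ω ∈ openConn p x).card ≤ j} ≤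
      (prodBernoulli w).real {ω : BondConfig (Fin n) | (A.filter fun x => ω ∈ openConn q x).card ≤ j}) :
    (prodBernoulli w).real {ω : BondConfig (Fin n) | (A.filter fun x => ω ∈ openConn p x).card ≤ j} -
        (prodBernoulli (Function.update w s(q, h) 1)).real
          {ω : BondConfig (Fin n) | (A.filter fun x => ω ∈ openConn p x).card ≤ j} ≤
      (prodBernoulli w).real {ω : BondConfig (Fin n) | (A.filter fun x => ω ∈ openConn q x).card ≤ j} -
        (prodBernoulli (Function.update w s(q, h) 1)).real
          {ω : BondConfig (Fin n) | (A.filter fun x => ω ∈ openConn q x).card ≤ j} := by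
  set μ := prodBernoulli w with hμ
  haveI : IsProbabilityMeasure μ := by rw [hμ]; infer_instance
  have hmeas : ∀ s : Set (BondConfig (Fin n)), MeasurableSet s := fun _ => MeasurableSet.of_discrete
  set e : Sym2 (Fin n) := s(q, h) with he
  set ins : BondConfig (Fin n) → BondConfig (Fin n) := fun ω => insert e ω with hins
  -- opening a pair only adds connections (cf. `TwoPortPeeling.reachable_insert_of_reachable`)
  have hri : ∀ (ω : BondConfig (Fin n)) (x y : Fin n), (openGraph ω).Reachable x y →
      (openGraph (insert e ω)).Reachable x y := by
    intro ω x y h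
    refine h.mono fun u v huv => ?_
    rw [openGraph_adj] at huv ⊢
    exact ⟨Set.mem_insert_of_mem _ huv.1, huv.2⟩
  -- relay counts before / after opening `e`
  set M : Fin n → BondConfig (Fin n) → ℕ := fun v ω => (A.filter fun x => ω ∈ openConn v x).card with hM
  set L : Fin n → Set (BondConfig (Fin n)) := fun v => {ω | M v ω ≤ j} with hL
  set L' : Fin n → Set (BondConfig (Fin n)) := fun v => ins ⁻¹' (L v) with hL'
  -- the raised measure is the image measure
  have hupd : ∀ v, (prodBernoulli (Function.update w s(q, h) 1)).real
      {ω : BondConfig (Fin n) | (A.filter fun x => ω ∈ openConn v x).card ≤ j} = μ.real (L' v) := by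
    intro v
    rw [ChampionStability.real_update_one_eq w hw0]
  rw [hupd p, hupd q]
  change μ.real (L p) - μ.real (L' p) ≤ μ.real (L q) - μ.real (L' q)
  -- monotonicity: L' v ⊆ L v
  have hmono : ∀ v ω, M v ω ≤ M v (ins ω) := by
    intro v ω
    apply card_filter_mono
    intro x _ hx
    exact hri ω _ _ hx
  have hsub : ∀ v, L' v ⊆ L v := by
    intro v ω hω
    change M v (ins ω) ≤ j at hω
    change M v ω ≤ j
    exact (hmono v ω).trans hω
  have hsd : ∀ s t : Set (BondConfig (Fin n)), t ⊆ s → μ.real s - μ.real t = μ.real (s \ t) := by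
    intro s t hts
    have := measureReal_inter_add_sdiff (μ := μ) (s := s) (t := t) (hmeas t)
    rw [inter_eq_right.2 hts] at this
    linarith
  have hdiff : ∀ v, μ.real (L v) - μ.real (L' v) = μ.real (L v \ L' v) := fun v => hsd _ _ (hsub v)
  rw [hdiff p, hdiff q]
  -- the two exchange events
  set W₁ : Set (BondConfig (Fin n)) := (openConn h p : Set (BondConfig (Fin n))) ∩
    {ω | j < (A.filter fun x => ω ∈ openConn p x).card ∧ (A.filter fun x => ω ∈ openConn q x).card ≤ j} with hW₁
  set W₂ : Set (BondConfig (Fin n)) := (openConn h p : Set (BondConfig (Fin n))) ∩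
    {ω | (A.filter fun x => ω ∈ openConn p x).card ≤ j ∧ j < (A.filter fun x => ω ∈ openConn q x).card} with hW₂
  have hW : μ.real W₂ ≤ μ.real W₁ :=
    observer_exchange_step w A h p q j (exchange_of_lonelier w A p q j hdom)
  -- after opening `e`, `q` reaches everything `p` reaches, provided `h ↔ p`
  have hq_reach : ∀ ω : BondConfig (Fin n), ω ∈ (openConn h p : Set (BondConfig (Fin n))) →
      ∀ x, (openGraph ω).Reachable p x → (openGraph (ins ω)).Reachable q x := by
    intro ω hhp x hpx
    have hhp' : (openGraph ω).Reachable h p := hhp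
    have h1 : (openGraph (ins ω)).Reachable q p := by
      rw [hins]
      exact (ChampionStability.reachable_insert_left_iff ω hqh p).2 (Or.inr hhp')
    exact h1.trans (hri ω _ _ hpx)
  have hMq_ge : ∀ ω : BondConfig (Fin n), ω ∈ (openConn h p : Set (BondConfig (Fin n))) → M p ω ≤ M q (ins ω) := by
    intro ω hhp
    apply card_filter_mono
    intro x _ hx
    exact hq_reach ω hhp x hx
  -- (d) W₁ ⊆ D_q
  have hW1sub : W₁ ⊆ L q \ L' q := by
    rintro ω ⟨hhp, hph, hql⟩
    refine ⟨hql, fun hω => ?_⟩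
    change M q (ins ω) ≤ j at hω
    have := hMq_ge ω hhp
    change (A.filter fun x => ω ∈ openConn p x).card ≤ M q (ins ω) at this
    omega
  -- (b),(c): D_p ⊆ (D_q \ W₁) ∪ W₂
  have hDp : L p \ L' p ⊆ (L q \ L' q) \ W₁ ∪ W₂ := by
    rintro ω ⟨hpl, hpn⟩
    change M p ω ≤ j at hpl
    have hpn' : ¬ M p (ins ω) ≤ j := hpn
    have hnotW1 : ω ∉ W₁ := by
      rintro ⟨_, hph, _⟩
      change j < M p ω at hph
      omega
    by_cases hpq : (openGraph ω).Reachable p q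
    · -- same cluster before and after
      left
      refine ⟨⟨?_, fun hω => hpn' ?_⟩, hnotW1⟩
      · change M q ω ≤ j
        have : M p ω = M q ω := card_eq_of_reachable A hpq
        omega
      · change M q (ins ω) ≤ j at hω
        have hpq' : (openGraph (ins ω)).Reachable p q := hri ω _ _ hpq
        have : M p (ins ω) = M q (ins ω) := card_eq_of_reachable A hpq'
        omega
    · -- p gains relays only through h
      have hph : (openGraph ω).Reachable h p := by
        by_contra hnot
        apply hpn'
        have hpnh : ¬ (openGraph ω).Reachable p h := fun h' => hnot h'.symm
        have key : ∀ x, (openGraph (ins ω)).Reachable p x ↔ (openGraph ω).Reachable p x := by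
          intro x
          rw [hins]
          exact ChampionStability.reachable_insert_iff_of_not ω hqh hpq hpnh x
        have : M p (ins ω) = M p ω := by
          apply le_antisymm
          · exact card_filter_mono A fun x _ hx => (key x).1 hx
          · exact hmono p ω
        omega
      have hhp : ω ∈ (openConn h p : Set (BondConfig (Fin n))) := hph
      by_cases hqh' : M q ω ≤ j
      · -- both light: ω ∈ D_q
        left
        refine ⟨⟨hqh', fun hω => hpn' ?_⟩, hnotW1⟩
        change M q (ins ω) ≤ j at hω
        -- M p (ins ω) ≤ M q (ins ω): q reaches p after the insertion
        have hqp' : (openGraph (ins ω)).Reachable q p := by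
          rw [hins]; exact (ChampionStability.reachable_insert_left_iff ω hqh p).2 (Or.inr hph)
        have : M p (ins ω) = M q (ins ω) := (card_eq_of_reachable A hqp').symm
        omega
      · right
        exact ⟨hhp, hpl, not_le.1 hqh'⟩
  -- measure bookkeeping
  have h1 : μ.real (L p \ L' p) ≤ μ.real ((L q \ L' q) \ W₁) + μ.real W₂ :=
    (measureReal_mono hDp (measure_ne_top μ _)).trans (measureReal_union_le _ _)
  have h2 : μ.real ((L q \ L' q) \ W₁) = μ.real (L q \ L' q) - μ.real W₁ :=
    (hsd _ _ hW1sub).symm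
  linarith

end ExchangeTools

end Summit.CriticalPhenomena.PercolationContinuityZ3.Theorems

end
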